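import Summits.RiemannHypothesis.RiemannHypothesis.Theses.WeilComb
import Summits.RiemannHypothesis.RiemannHypothesis.Theorems.CombShapePositivity.Negative.WeilCombCombShapePositivityLoadBearing
import Summits.RiemannHypothesis.RiemannHypothesis.Theorems.WeilCombCombShapePositivityStubScreeningProfile
import Summits.RiemannHypothesis.RiemannHypothesis.Theorems.WeilCombCombShapePositivityWindowCoreConeK11
import Literature.NumberTheory.LFunctions.WeilWindowSimpleEven
import Literature.NumberTheory.LFunctions.WeilGroundEnergyProofs
import Literature.NumberTheory.LFunctions.WeilExplicitProofs

/-!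
# Top cells from the Perron pivot (plan B9 of `STUB-PLAN-stub_windowCore`, line `Sketch`)
(crux `WeilComb.CombShapePositivity`, item stmt-RiemannHypothesis-11229)

**Theorem** (`stub_topCellsFromPivot`, registered). Let `g_a = Σ_{m ≤ M} a_m φ_ε(· − log m)` be the
fixed-shape comb, `u_m = m^{-1/2}` the Perron ray, `U = ε⁻¹‖φ₀‖₂²`, `H_M = Σ_{m ≤ M} 1/m = ‖u‖²`.
Assume, on the top cells `2ε(M+1) ≤ 1 < 2ε(M+2)` with `M ≥ 400`:
* (Rayleigh, plan B4) `Re Q(g_u) ≥ (1/20)·U·H_M`;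
* (cross term, plan B5) `|W(g_u ⋆ g̃_y)|² ≤ (1/16)·U²·‖y‖²` for every `y ⊥ u` (`Σ y_m u_m = 0`);
* (coercivity on `u^⊥`, plan B7) `Re Q(g_y) ≥ (1/5)·U·‖y‖²` for every `y ⊥ u`.
Then `Re Q(g_b) ≥ 0` for every REAL coefficient vector `b` on those cells (`TopCellsFrom 400`).

**Proof** (the 2×2 Schur complement of the Perron pivot, in the language of test functions).
Write `a = βu + y` with `β = ⟨a,u⟩/H_M`, so `y ⊥ u`; the comb is linear in its coefficients, hence
`g_a = β g_u + g_y`, and by the polarisation identities of the tree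
(`weilQuadratic_add`, `weilQuadratic_const_mul`, `weilConv_const_mul_left/right`, `weilReflect_const_mul`,
`weilFunctional_const_mul`, and the Hermitian symmetry `W(h ⋆ g̃) = conj W(g ⋆ h̃)` from
`(g ⋆ h̃)~ = h ⋆ g̃` + `conj W(k) = W(k̃)`, re-proved here as private lemmas — adapted from
`…Theorems.WeilGroundStateGroundStatesConvergeToXiEulerLagrange`, which cannot be imported together with
`Literature…WeilWindowSimpleEven` because of a declaration/module name clash)
`Re Q(g_a) = |β|² Re Q(g_u) + Re Q(g_y) + 2 Re(β W(g_u ⋆ g̃_y))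
 ≥ U·((1/20)H t² − (1/2) t w + (1/5) w²)`, `t = |β|`, `w = ‖y‖`,
and `20H·((1/20)H t² − (1/2)tw + (1/5)w²) = (Ht − 5w)² + (4H − 25)w² ≥ 0` because `H_M ≥ 25/4` for
`M ≥ 400` (`stub_closureConstants`, plan B8).
-/

noncomputable section

-- the sub-problem path `RiemannHypothesis/RiemannHypothesis` (single-conjunct summit, D-0017) duplicates a namespace
set_option linter.dupNamespace false

open scoped BigOperators ComplexConjugate
open Complex MeasureTheory

namespace Summit.RiemannHypothesis.RiemannHypothesis.Theorems.WeilCombBohrFejer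

open Literature.NumberTheory.LFunctions

/-- `(g ⋆ h̃)~ = h ⋆ g̃` for all `g h : ℝ → ℂ` (no hypotheses; conjugation and translation commute with the
Bochner integral). Adapted from `…WeilGroundStateGroundStatesConvergeToXiEulerLagrange.weilReflect_weilConv_weilReflect`.
[folklore] -/
private theorem weilReflect_weilConv_weilReflect_b9 (g h : ℝ → ℂ) :
    weilReflect (weilConv g (weilReflect h)) = weilConv h (weilReflect g) := by
  funext t
  change conj (weilConv g (weilReflect h) (-t)) = weilConv h (weilReflect g) t
  rw [weilConv_apply, weilConv_apply, ← integral_conj,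
    ← integral_add_right_eq_self (fun u : ℝ => h u * weilReflect g (t - u)) t]
  refine integral_congr_ae (Filter.Eventually.of_forall fun u => ?_)
  have h1 : -(-t - u) = u + t := by ring
  have h2 : -(t - (u + t)) = u := by ring
  simp only [weilReflect, map_mul, Complex.conj_conj, h1, h2]
  exact mul_comm _ _

/-- `conj W(k) = W(k̃)` for every `k : ℝ → ℂ` (no hypotheses; term by term with `(k̃)^(s) = conj k̂(1 − conj s)`,
`weilMellin_weilReflect_holds`). Adapted from
`…WeilGroundStateGroundStatesConvergeToXiEulerLagrange.conj_weilFunctional_eq_weilReflect`. [folklore] -/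
private theorem conj_weilFunctional_eq_weilReflect_b9 (k : ℝ → ℂ) :
    conj (weilFunctional k) = weilFunctional (weilReflect k) := by
  have hM : ∀ s : ℂ, weilMellin (weilReflect k) s = conj (weilMellin k (1 - conj s)) :=
    fun s => weilMellin_weilReflect_holds k s
  have h0 : weilReflect k 0 = conj (k 0) := by simp [weilReflect]
  have hP : conj (weilPolarTerm k) = weilPolarTerm (weilReflect k) := by
    rw [weilPolarTerm, weilPolarTerm, map_add, hM, hM, map_zero, map_one, sub_zero, sub_self,
      add_comm]
  have hΛ : conj (weilPrimeTerm k) = weilPrimeTerm (weilReflect k) := by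
    rw [weilPrimeTerm, weilPrimeTerm, Complex.conj_tsum]
    refine tsum_congr fun n => ?_
    rw [map_mul, map_div₀, Complex.conj_ofReal, Complex.conj_ofReal, map_add]
    simp only [weilReflect, neg_neg]
    ring
  have hA : conj (weilArchTerm k) = weilArchTerm (weilReflect k) := by
    rw [weilArchTerm, weilArchTerm, map_sub, map_mul, map_mul, h0, Complex.conj_ofReal,
      weilArchIntegral, weilArchIntegral, ← integral_conj]
    congr 2
    · rw [map_div₀, map_one, map_mul, map_ofNat, Complex.conj_ofReal]
    · refine integral_congr_ae (Filter.Eventually.of_forall fun t => ?_)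
      dsimp only
      rw [map_mul, Complex.conj_ofReal, hM]
      congr 3
      rw [map_add, map_mul, Complex.conj_ofReal, Complex.conj_I, map_div₀, map_one, map_ofNat]
      ring
  rw [weilFunctional, weilFunctional, map_add, map_sub, hP, hΛ, hA]

/-- `Σ_{m ≤ M} u_m · u_m = H_M` in `ℂ` for the Perron ray `u_m = m^{-1/2}`. [folklore] -/
private theorem sum_perron_mul_perron_b9 (M : ℕ) :
    ∑ m ∈ Finset.Icc 1 M, ((Real.sqrt (m : ℝ) : ℝ) : ℂ)⁻¹ * ((Real.sqrt (m : ℝ) : ℝ) : ℂ)⁻¹ =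
      ((∑ m ∈ Finset.Icc 1 M, (1 : ℝ) / m : ℝ) : ℂ) := by
  push_cast
  refine Finset.sum_congr rfl fun m hm => ?_
  have hm0 : (0 : ℝ) ≤ (m : ℝ) := by positivity
  rw [← mul_inv, ← Complex.ofReal_mul, Real.mul_self_sqrt hm0]
  push_cast
  ring

/-- The elementary closure inequality of the pivot: for `H ≥ 25/4`, `t, w` real,
`0 ≤ (1/20)·H·t² − (1/2)·t·w + (1/5)·w²` (`20H` times it is `(Ht − 5w)² + (4H − 25)w²`). [folklore] -/
private theorem pivot_closure_b9 {H t w : ℝ} (hH : 25 / 4 ≤ H) :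
    0 ≤ 1 / 20 * H * t ^ 2 - 1 / 2 * t * w + 1 / 5 * w ^ 2 := by
  have hH0 : 0 < H := by linarith
  have key : 20 * H * (1 / 20 * H * t ^ 2 - 1 / 2 * t * w + 1 / 5 * w ^ 2) =
      (H * t - 5 * w) ^ 2 + (4 * H - 25) * w ^ 2 := by ring
  have hnn : 0 ≤ (H * t - 5 * w) ^ 2 + (4 * H - 25) * w ^ 2 := by
    have : 0 ≤ (4 * H - 25) * w ^ 2 := mul_nonneg (by linarith) (sq_nonneg w)
    positivity
  by_contra h
  push Not at h
  have : 20 * H * (1 / 20 * H * t ^ 2 - 1 / 2 * t * w + 1 / 5 * w ^ 2) < 0 :=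
    mul_neg_of_pos_of_neg (by positivity) h
  linarith

/-- **Plan B9 (`stub_topCellsFromPivot`): the top cells from the Perron pivot.** If on the top cells
`2ε(M+1) ≤ 1 < 2ε(M+2)`, `M ≥ 400`, the Perron Rayleigh quotient is at least `(1/20)·U·H_M` (B4), the
screened cross term satisfies `|W(g_u ⋆ g̃_y)|² ≤ (1/16)·U²·‖y‖²` on `u^⊥` (B5) and the form is coercive
on `u^⊥` with constant `1/5` (B7), then the fixed-shape comb form is nonnegative on every real vector on
those cells (`TopCellsFrom 400`).  Pure plumbing: comb linearity, polarisation of `Q`, Hermitian symmetry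
of the cross term, and the closure arithmetic `H_M ≥ 25/4` (`stub_closureConstants`). -/
theorem stub_topCellsFromPivot :
    (∀ ε : ℝ, 0 < ε → ∀ M : ℕ, 400 ≤ M → 2 * ε * ((M : ℝ) + 1) ≤ 1 → 1 < 2 * ε * ((M : ℝ) + 2) →
      1 / 20 * (ε⁻¹ * weilNorm2Sq (fun u : ℝ => ((expNegInvGlue (1 - u ^ 2) : ℝ) : ℂ))) *
          (∑ m ∈ Finset.Icc 1 M, (1 : ℝ) / m) ≤
        (weilQuadratic (fun x : ℝ => ∑ m ∈ Finset.Icc 1 M,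
          ((Real.sqrt (m : ℝ) : ℝ) : ℂ)⁻¹ *
            ((ε : ℂ)⁻¹ * ((expNegInvGlue (1 - ((x - Real.log (m : ℝ)) / ε) ^ 2) : ℝ) : ℂ)))).re) →
    (∀ ε : ℝ, 0 < ε → ∀ (M : ℕ) (y : ℕ → ℂ), 400 ≤ M → 2 * ε * ((M : ℝ) + 1) ≤ 1 →
      1 < 2 * ε * ((M : ℝ) + 2) →
      ∑ m ∈ Finset.Icc 1 M, y m * ((Real.sqrt (m : ℝ) : ℝ) : ℂ)⁻¹ = 0 →
      ‖weilFunctional (weilConv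
          (fun x : ℝ => ∑ m ∈ Finset.Icc 1 M,
            ((Real.sqrt (m : ℝ) : ℝ) : ℂ)⁻¹ *
              ((ε : ℂ)⁻¹ * ((expNegInvGlue (1 - ((x - Real.log (m : ℝ)) / ε) ^ 2) : ℝ) : ℂ)))
          (weilReflect (fun x : ℝ => ∑ m ∈ Finset.Icc 1 M,
            y m * ((ε : ℂ)⁻¹ * ((expNegInvGlue (1 - ((x - Real.log (m : ℝ)) / ε) ^ 2) : ℝ) : ℂ)))))‖ ^ 2 ≤
        1 / 16 * (ε⁻¹ * weilNorm2Sq (fun u : ℝ => ((expNegInvGlue (1 - u ^ 2) : ℝ) : ℂ))) ^ 2 *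
          ∑ m ∈ Finset.Icc 1 M, ‖y m‖ ^ 2) →
    (∀ ε : ℝ, 0 < ε → ∀ (M : ℕ) (y : ℕ → ℂ), 400 ≤ M → 2 * ε * ((M : ℝ) + 1) ≤ 1 →
      1 < 2 * ε * ((M : ℝ) + 2) →
      ∑ m ∈ Finset.Icc 1 M, y m * ((Real.sqrt (m : ℝ) : ℝ) : ℂ)⁻¹ = 0 →
      1 / 5 * (ε⁻¹ * weilNorm2Sq (fun u : ℝ => ((expNegInvGlue (1 - u ^ 2) : ℝ) : ℂ))) *
          ∑ m ∈ Finset.Icc 1 M, ‖y m‖ ^ 2 ≤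
        (weilQuadratic (fun x : ℝ => ∑ m ∈ Finset.Icc 1 M,
          y m * ((ε : ℂ)⁻¹ * ((expNegInvGlue (1 - ((x - Real.log (m : ℝ)) / ε) ^ 2) : ℝ) : ℂ)))).re) →
    ∀ ε : ℝ, 0 < ε → ∀ (M : ℕ) (b : ℕ → ℝ), 400 ≤ M → 2 * ε * ((M : ℝ) + 1) ≤ 1 →
      1 < 2 * ε * ((M : ℝ) + 2) →
      0 ≤ (weilQuadratic (fun x : ℝ => ∑ m ∈ Finset.Icc 1 M,
        ((b m : ℝ) : ℂ) * ((ε : ℂ)⁻¹ * ((expNegInvGlue (1 - ((x - Real.log (m : ℝ)) / ε) ^ 2) : ℝ) : ℂ)))).re := by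
  intro hRay hcross hcoer ε hε M b hM hw htop
  -- notation
  set φ : ℝ → ℕ → ℂ := fun x m =>
    (ε : ℂ)⁻¹ * ((expNegInvGlue (1 - ((x - Real.log (m : ℝ)) / ε) ^ 2) : ℝ) : ℂ) with hφ
  set u : ℕ → ℂ := fun m => ((Real.sqrt (m : ℝ) : ℝ) : ℂ)⁻¹ with hu
  set a : ℕ → ℂ := fun m => ((b m : ℝ) : ℂ) with ha
  set H : ℝ := ∑ m ∈ Finset.Icc 1 M, (1 : ℝ) / m with hH
  set U : ℝ := ε⁻¹ * weilNorm2Sq (fun u : ℝ => ((expNegInvGlue (1 - u ^ 2) : ℝ) : ℂ)) with hU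
  have hH25 : 25 / 4 ≤ H := by
    have h := stub_closureConstants M hM
    rw [← hH] at h
    linarith
  have hHpos : 0 < H := by linarith
  have hU0 : 0 ≤ U := mul_nonneg (inv_nonneg.2 hε.le) (weilNorm2Sq_nonneg _)
  -- the pivot decomposition `a = β u + y`, `y ⊥ u`
  set s : ℂ := ∑ m ∈ Finset.Icc 1 M, a m * u m with hs
  set β : ℂ := s / (H : ℂ) with hβ
  set y : ℕ → ℂ := fun m => a m - β * u m with hy
  have huu : ∑ m ∈ Finset.Icc 1 M, u m * u m = (H : ℂ) := by
    rw [hu, hH]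
    exact sum_perron_mul_perron_b9 M
  have hperp : ∑ m ∈ Finset.Icc 1 M, y m * ((Real.sqrt (m : ℝ) : ℝ) : ℂ)⁻¹ = 0 := by
    have e : ∀ m, y m * ((Real.sqrt (m : ℝ) : ℝ) : ℂ)⁻¹ = a m * u m - β * (u m * u m) := by
      intro m
      simp only [hy, hu]
      ring
    simp_rw [e]
    rw [Finset.sum_sub_distrib, ← Finset.mul_sum, huu, ← hs, hβ]
    have hH0 : (H : ℂ) ≠ 0 := by exact_mod_cast hHpos.ne'
    field_simp
    ring
  -- the three combs
  set gA : ℝ → ℂ := fun x : ℝ => ∑ m ∈ Finset.Icc 1 M, ((b m : ℝ) : ℂ) * φ x m with hgA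
  set gU : ℝ → ℂ := fun x : ℝ => ∑ m ∈ Finset.Icc 1 M, ((Real.sqrt (m : ℝ) : ℝ) : ℂ)⁻¹ * φ x m
    with hgU
  set gY : ℝ → ℂ := fun x : ℝ => ∑ m ∈ Finset.Icc 1 M, y m * φ x m with hgY
  have hWU : IsWeilTest gU :=
    Summit.RiemannHypothesis.RiemannHypothesis.Theorems.weilComb_shapeComb_isWeilTest ε M u
  have hWY : IsWeilTest gY :=
    Summit.RiemannHypothesis.RiemannHypothesis.Theorems.weilComb_shapeComb_isWeilTest ε M y
  have hWβU : IsWeilTest (fun t : ℝ => β * gU t) := hWU.const_mul β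
  -- comb linearity: `g_a = β g_u + g_y`
  have hdec : gA = (fun t : ℝ => β * gU t) + gY := by
    funext t
    simp only [hgA, hgU, hgY, Pi.add_apply, Finset.mul_sum, ← Finset.sum_add_distrib]
    refine Finset.sum_congr rfl fun m _ => ?_
    simp only [hy, ha, hu]
    ring
  -- the cross term and its Hermitian symmetry
  set C : ℂ := weilFunctional (weilConv gU (weilReflect gY)) with hC
  have hcross1 : weilFunctional (weilConv (fun t : ℝ => β * gU t) (weilReflect gY)) = β * C := by
    rw [weilConv_const_mul_left, weilFunctional_const_mul]
  have hcross2 : weilFunctional (weilConv gY (weilReflect (fun t : ℝ => β * gU t))) =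
      conj β * conj C := by
    rw [weilReflect_const_mul, weilConv_const_mul_right, weilFunctional_const_mul]
    congr 1
    rw [hC, conj_weilFunctional_eq_weilReflect_b9, weilReflect_weilConv_weilReflect_b9]
  -- polarisation
  have hQ : weilQuadratic gA =
      (Complex.normSq β : ℂ) * weilQuadratic gU + weilQuadratic gY + (β * C + conj β * conj C) := by
    rw [hdec, weilQuadratic_add hWβU hWY, weilQuadratic_const_mul, hcross1, hcross2]
  have hQre : (weilQuadratic gA).re =
      Complex.normSq β * (weilQuadratic gU).re + (weilQuadratic gY).re + 2 * (β * C).re := by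
    rw [hQ]
    have e : conj β * conj C = conj (β * C) := by rw [map_mul]
    rw [e, Complex.add_re, Complex.add_re, Complex.add_conj, Complex.re_ofReal_mul]
    simp
  -- the three analytic inputs
  have hRay' : 1 / 20 * U * H ≤ (weilQuadratic gU).re := hRay ε hε M hM hw htop
  have hcoer' : 1 / 5 * U * ∑ m ∈ Finset.Icc 1 M, ‖y m‖ ^ 2 ≤ (weilQuadratic gY).re :=
    hcoer ε hε M y hM hw htop hperp
  have hcross' : ‖C‖ ^ 2 ≤ 1 / 16 * U ^ 2 * ∑ m ∈ Finset.Icc 1 M, ‖y m‖ ^ 2 :=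
    hcross ε hε M y hM hw htop hperp
  -- scalar bookkeeping
  set t : ℝ := ‖β‖ with ht
  set Y2 : ℝ := ∑ m ∈ Finset.Icc 1 M, ‖y m‖ ^ 2 with hY2
  have hY2 : 0 ≤ Y2 := Finset.sum_nonneg fun _ _ => by positivity
  set w : ℝ := Real.sqrt Y2 with hw'
  have hw0 : 0 ≤ w := Real.sqrt_nonneg _
  have hwsq : w ^ 2 = Y2 := Real.sq_sqrt hY2
  have hnormSq : Complex.normSq β = t ^ 2 := by rw [Complex.normSq_eq_norm_sq]
  -- `‖C‖ ≤ U w / 4`, hence `Re(β C) ≥ −t U w / 4`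
  have hCle : ‖C‖ ≤ U * w / 4 := by
    have h1 : ‖C‖ ^ 2 ≤ (U * w / 4) ^ 2 := by
      have e : (U * w / 4) ^ 2 = 1 / 16 * U ^ 2 * Y2 := by
        rw [div_pow, mul_pow, hwsq]
        ring
      rw [e]
      exact hcross'
    have hnn : 0 ≤ U * w / 4 := by positivity
    exact (pow_le_pow_iff_left₀ (norm_nonneg _) hnn two_ne_zero).1 h1
  have hre : -(t * (U * w / 4)) ≤ (β * C).re := by
    have h := Complex.abs_re_le_norm (β * C)
    rw [norm_mul] at h
    have h2 : ‖β‖ * ‖C‖ ≤ t * (U * w / 4) := by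
      rw [ht]
      exact mul_le_mul_of_nonneg_left hCle (norm_nonneg _)
    have h3 := (abs_le.1 h).1
    linarith
  -- assemble
  have key : 0 ≤ 1 / 20 * H * t ^ 2 - 1 / 2 * t * w + 1 / 5 * w ^ 2 := pivot_closure_b9 hH25
  have h1 : t ^ 2 * (1 / 20 * U * H) ≤ t ^ 2 * (weilQuadratic gU).re :=
    mul_le_mul_of_nonneg_left hRay' (sq_nonneg t)
  rw [← hwsq] at hcoer'
  have hmain : U * (1 / 20 * H * t ^ 2 - 1 / 2 * t * w + 1 / 5 * w ^ 2) ≤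
      Complex.normSq β * (weilQuadratic gU).re + (weilQuadratic gY).re + 2 * (β * C).re := by
    rw [hnormSq]
    linarith
  have hgoal : 0 ≤ (weilQuadratic gA).re := by
    rw [hQre]
    exact le_trans (mul_nonneg hU0 key) hmain
  simpa [hgA, hφ] using hgoal


/-- **The registered stub from the pivot, conditionally (plan §1.3 composition / fallback F1 shape).**
If, besides the three analytic inputs of `stub_topCellsFromPivot` (B4 Rayleigh, B5 cross term, B7
coercivity on `u^⊥`, all on the top cells with `M ≥ 400`), the finitely many top cells `2 ≤ M < 400`
are known (`TopCellsBelow 400`, computational), then `stub_windowCore` holds in its v7 form (band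
`1/40 < εM`, hence also the v8.1 band `1/20 < εM`): GLUE through the landed
`stub_windowCore_iff_topCells_real` (…WindowCoreConeK11). -/
theorem windowCore_of_pivot_of_cells
    (hRay : ∀ ε : ℝ, 0 < ε → ∀ M : ℕ, 400 ≤ M → 2 * ε * ((M : ℝ) + 1) ≤ 1 → 1 < 2 * ε * ((M : ℝ) + 2) →
      1 / 20 * (ε⁻¹ * weilNorm2Sq (fun u : ℝ => ((expNegInvGlue (1 - u ^ 2) : ℝ) : ℂ))) *
          (∑ m ∈ Finset.Icc 1 M, (1 : ℝ) / m) ≤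
        (weilQuadratic (fun x : ℝ => ∑ m ∈ Finset.Icc 1 M,
          ((Real.sqrt (m : ℝ) : ℝ) : ℂ)⁻¹ *
            ((ε : ℂ)⁻¹ * ((expNegInvGlue (1 - ((x - Real.log (m : ℝ)) / ε) ^ 2) : ℝ) : ℂ)))).re)
    (hcross : ∀ ε : ℝ, 0 < ε → ∀ (M : ℕ) (y : ℕ → ℂ), 400 ≤ M → 2 * ε * ((M : ℝ) + 1) ≤ 1 →
      1 < 2 * ε * ((M : ℝ) + 2) →
      ∑ m ∈ Finset.Icc 1 M, y m * ((Real.sqrt (m : ℝ) : ℝ) : ℂ)⁻¹ = 0 →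
      ‖weilFunctional (weilConv
          (fun x : ℝ => ∑ m ∈ Finset.Icc 1 M,
            ((Real.sqrt (m : ℝ) : ℝ) : ℂ)⁻¹ *
              ((ε : ℂ)⁻¹ * ((expNegInvGlue (1 - ((x - Real.log (m : ℝ)) / ε) ^ 2) : ℝ) : ℂ)))
          (weilReflect (fun x : ℝ => ∑ m ∈ Finset.Icc 1 M,
            y m * ((ε : ℂ)⁻¹ * ((expNegInvGlue (1 - ((x - Real.log (m : ℝ)) / ε) ^ 2) : ℝ) : ℂ)))))‖ ^ 2 ≤
        1 / 16 * (ε⁻¹ * weilNorm2Sq (fun u : ℝ => ((expNegInvGlue (1 - u ^ 2) : ℝ) : ℂ))) ^ 2 *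
          ∑ m ∈ Finset.Icc 1 M, ‖y m‖ ^ 2)
    (hcoer : ∀ ε : ℝ, 0 < ε → ∀ (M : ℕ) (y : ℕ → ℂ), 400 ≤ M → 2 * ε * ((M : ℝ) + 1) ≤ 1 →
      1 < 2 * ε * ((M : ℝ) + 2) →
      ∑ m ∈ Finset.Icc 1 M, y m * ((Real.sqrt (m : ℝ) : ℝ) : ℂ)⁻¹ = 0 →
      1 / 5 * (ε⁻¹ * weilNorm2Sq (fun u : ℝ => ((expNegInvGlue (1 - u ^ 2) : ℝ) : ℂ))) *
          ∑ m ∈ Finset.Icc 1 M, ‖y m‖ ^ 2 ≤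
        (weilQuadratic (fun x : ℝ => ∑ m ∈ Finset.Icc 1 M,
          y m * ((ε : ℂ)⁻¹ * ((expNegInvGlue (1 - ((x - Real.log (m : ℝ)) / ε) ^ 2) : ℝ) : ℂ)))).re)
    (hcells : ∀ ε : ℝ, 0 < ε → ∀ (M : ℕ) (b : ℕ → ℝ), 2 ≤ M → M < 400 → 2 * ε * ((M : ℝ) + 1) ≤ 1 →
      1 < 2 * ε * ((M : ℝ) + 2) →
      0 ≤ (weilQuadratic (fun x : ℝ => ∑ m ∈ Finset.Icc 1 M,
        ((b m : ℝ) : ℂ) * ((ε : ℂ)⁻¹ * ((expNegInvGlue (1 - ((x - Real.log (m : ℝ)) / ε) ^ 2) : ℝ) : ℂ)))).re) :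
    ∀ ε : ℝ, 0 < ε → ∀ (M : ℕ) (a : ℕ → ℂ), 1 ≤ M → 1 / 40 < ε * M →
      2 * ε * ((M : ℝ) + 1) ≤ 1 →
      ε⁻¹ * weilNorm2Sq (fun u : ℝ => ((expNegInvGlue (1 - u ^ 2) : ℝ) : ℂ)) *
          (2 * (∑ m ∈ Finset.Icc 1 M, ∑ n ∈ Finset.Icc 1 (M / m),
              ((ArithmeticFunction.vonMangoldt n : ℝ) : ℂ) / (Real.sqrt n : ℂ) * a (n * m) *
                conj (a m)).re
            + Real.log Real.pi * ∑ m ∈ Finset.Icc 1 M, ‖a m‖ ^ 2) ≤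
        2 * (weilMellin (fun t : ℝ => (ε : ℂ)⁻¹ * ((expNegInvGlue (1 - (t / ε) ^ 2) : ℝ) : ℂ)) 0 *
              conj (weilMellin (fun t : ℝ => (ε : ℂ)⁻¹ * ((expNegInvGlue (1 - (t / ε) ^ 2) : ℝ) : ℂ)) 1) *
            ((∑ m ∈ Finset.Icc 1 M, a m * ((Real.sqrt (m : ℝ) : ℝ) : ℂ)⁻¹) *
              conj (∑ m ∈ Finset.Icc 1 M, a m * ((Real.sqrt (m : ℝ) : ℝ) : ℂ)))).re
        + 1 / (2 * Real.pi) * ∫ t : ℝ,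
            ‖weilMellin (fun t : ℝ => (ε : ℂ)⁻¹ * ((expNegInvGlue (1 - (t / ε) ^ 2) : ℝ) : ℂ))
                (1 / 2 + t * I)‖ ^ 2 *
              ‖∑ m ∈ Finset.Icc 1 M, a m * cexp (t * I * (Real.log (m : ℝ) : ℂ))‖ ^ 2 *
              (Complex.digamma (1 / 4 + t / 2 * I)).re :=
  stub_windowCore_iff_topCells_real.2 fun ε hε M b hM hw htop => by
    by_cases h : M < 400
    · exact hcells ε hε M b hM h hw htop
    · exact stub_topCellsFromPivot hRay hcross hcoer ε hε M b (by omega) hw htop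

end Summit.RiemannHypothesis.RiemannHypothesis.Theorems.WeilCombBohrFejer

end
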